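import Mathlib
import HarnessLib
import HarnessLib.Audit
import Summits.CriticalPhenomena.PercolationContinuityZ3.Theorems.PercNearOneGluingNoHeavyLowerTailHexMSMatchNonFull

/-!
# Conjecture (MATCH), two dead classes: slack from an MS-tight family through the missing member (hp-7 gen 70)

Support file for crux `stmt-CriticalPhenomena-4575` (route `PercNearOneGluingNoHeavy`), hull-port seat `prim-hp-7` (generation 70);
`--supports stmt-CriticalPhenomena-4575`.  No `sorry`, no definition.  Memo: `run/shared/lean/prim/prim-hp-7/FROM-prim-hp-7-g70-MS-EQUALITY.md` §4 (i).

Towards 'non-full ⟹ slack ≥ 2' (`…HexMSMatchNonFull`): let `G` be a two-class dead family and `s ∉ G` a dead member of its classes.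
* `sdiff_notMem_of_tight` — in an MS-tight two-class dead family no difference of two members is a member;
* `sdiff_mem_candidates_compl_of_notMem` — `a \ b ∈ C(U \ b)` and `U \ (a \ b) ∈ C(U \ a)` for dead `a, b` of the two classes with `a \ b ∉ 𝒟`;
* `cl_diffs_subset_biUnion_candidates_of_tight_outer` — **if `T ∋ s` is MS-tight with `T ∖ {s} ⊆ G ≠ ∅`, then `cl ΔT ⊆ N(cl G)`** (every difference
  `t \ t'` is a candidate both of `t` and of `U \ t'`, and one of them lies in `cl G`);
* `two_mul_card_add_two_le_card_biUnion_candidates_of_insert_tight` — hence **if `insert s G` is MS-tight then `#N(cl G) ≥ 2 #G + 2`**;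
* `two_mul_card_add_two_le_card_biUnion_candidates_of_insert_erase_tight` — and **if `insert s (G.erase g)` is MS-tight (`g ∈ G` of the upper label)
  then `#N(cl G) ≥ 2 #G + 2`** (plus the key-lemma pair for `g`, via `exists_candidate_notMem_cl_diffs''` of `…HexMSMatchNonFull`).
* `two_mul_card_add_two_le_card_biUnion_candidates_of_noBlocker` — (S2): **a two-class dead family without blocked pairs and with `#ΔG ≥ #G + 1` has
  `#N(cl G) ≥ 2 #G + 2`** (so only non-MS-tight families WITH blocked pairs remain for 'non-full ⟹ slack ≥ 2', memo §4 (j)).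
Together with `…HexMSMatchNonFull` (the case `G` MS-tight) these are the codimension ≤ 1 instances of the architecture of memo §4 (i); the general
case needs a non-local source of candidates for the second and later members outside a tight `T ∋ s`.
-/

namespace Summit.CriticalPhenomena.PercolationContinuityZ3.Theorems

namespace GeneratedDonors

open Finset FinsetFamily

variable {α : Type*} [DecidableEq α]

section OuterTight

/-! ### A tight family THROUGH the outside member: `cl Δ(T) ⊆ N(cl G)` for MS-tight `T ∋ s` with `T ∖ {s} ⊆ G`, and slack for `G` when `G ∪ {s}` is tight -/

variable {U : Finset α} {𝒟 : Finset (Finset α)} {x : Finset α → ZMod 6}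

/-- For dead `a, b` with labels in `{ℓ, ℓ+1}` and `a \ b ∉ 𝒟`: `a \ b` is a candidate of `U \ b` (partner `a`) and `U \ (a \ b)` a candidate of `U \ a`
(partner `U \ b`... i.e. `(U \ a) ∪ b`, partner `b`). -/
theorem sdiff_mem_candidates_compl_of_notMem (hU : ∀ a ∈ 𝒟, a ⊆ U) (hco : ∀ a ∈ 𝒟, U \ a ∈ 𝒟)
    (hanti : ∀ a ∈ 𝒟, x (U \ a) = x a + 3) {ℓ : ZMod 6} {a b : Finset α} (ha : a ∈ 𝒟) (hb : b ∈ 𝒟)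
    (hal : x a = ℓ ∨ x a = ℓ + 1) (hbl : x b = ℓ ∨ x b = ℓ + 1) (h1 : a \ b ∉ 𝒟) :
    a \ b ∈ candidates 𝒟 x (U \ b) ∧ U \ (a \ b) ∈ candidates 𝒟 x (U \ a) := by
  have key : ∀ i s t : ZMod 6, (s = i ∨ s = i + 1) → (t = i ∨ t = i + 1) → ¬ Close (s + 3) t := by decide
  have hfar1 : ¬ Close (x (U \ b)) (x a) := by rw [hanti b hb]; exact key ℓ _ _ hbl hal
  have hfar2 : ¬ Close (x (U \ a)) (x b) := by rw [hanti a ha]; exact key ℓ _ _ hal hbl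
  have haU := hU a ha; have hbU := hU b hb
  have e1 : a \ b = (U \ b) ∩ a := by
    ext i; simp only [mem_sdiff, mem_inter]
    have h := @haU i; grind
  have e2 : U \ (a \ b) = (U \ a) ∪ b := by
    ext i; simp only [mem_sdiff, mem_union]
    have h := @hbU i; grind
  have h2 : U \ (a \ b) ∉ 𝒟 := fun h => h1 (by
    have h' := hco _ h
    rwa [Finset.sdiff_sdiff_eq_self (sdiff_subset.trans haU)] at h')
  unfold candidates
  exact ⟨mem_sdiff.mpr ⟨mem_farProducts.mpr ⟨a, ha, hfar1, Or.inl e1⟩, h1⟩,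
    mem_sdiff.mpr ⟨mem_farProducts.mpr ⟨b, hb, hfar2, Or.inr e2⟩, h2⟩⟩

/-- In an MS-tight two-class dead family no difference of two members is a member (same label: never; adjacent labels: no blockers, gen 69). -/
theorem sdiff_notMem_of_tight (hU : ∀ a ∈ 𝒟, a ⊆ U) (hco : ∀ a ∈ 𝒟, U \ a ∈ 𝒟)
    (hanti : ∀ a ∈ 𝒟, x (U \ a) = x a + 3) {T : Finset (Finset α)} (hT : T ⊆ dead U 𝒟 x) {ℓ : ZMod 6}
    (hlab : ∀ t ∈ T, x t = ℓ ∨ x t = ℓ + 1) (ht : #(T \\ T) = #T) {f g : Finset α} (hf : f ∈ T) (hg : g ∈ T) : f \ g ∉ 𝒟 := by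
  have hTD : ∀ t ∈ T, t ∈ 𝒟 := fun t h => (mem_filter.mp (hT h)).1
  have hne : T.Nonempty := ⟨f, hf⟩
  obtain ⟨c, _, hpiv⟩ := TwistedAD.exists_pivot_of_card_diffs_eq_card T ht hne
  have hTeq : T = ((T.image (c \ ·)) ×ˢ (T.image (· \ c))).image (fun e => ∅ ∪ (c \ e.1) ∪ e.2) := by
    rw [show (fun e : Finset α × Finset α => ∅ ∪ (c \ e.1) ∪ e.2) = (fun e => (c \ e.1) ∪ e.2) from
      funext fun e => by rw [empty_union]]
    exact eq_twistedProduct_of_pivot ht.le hpiv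
  have hd₁I : ∀ d ∈ T.image (c \ ·), d ⊆ c := by
    intro d hd; obtain ⟨g, _, rfl⟩ := mem_image.mp hd; exact sdiff_subset
  have hd₂ : ∀ d ∈ T.image (· \ c), Disjoint d (∅ ∪ c) := by
    intro d hd; obtain ⟨g, _, rfl⟩ := mem_image.mp hd; rw [empty_union]; exact disjoint_sdiff_self_left
  have key : ∀ i s t : ZMod 6, (s = i ∨ s = i + 1) → (t = i ∨ t = i + 1) → s = t ∨ t = s + 1 ∨ s = t + 1 := by decide
  rcases key ℓ _ _ (hlab f hf) (hlab g hg) with h | h | h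
  · exact (sdiff_notMem_of_dead_of_label_eq hU hco hanti (hTD f hf) (hTD g hg) (mem_filter.mp (hT hf)).2
      (mem_filter.mp (hT hg)).2 h).2
  · exact (not_blocked_of_twistedProduct hU hco hanti hd₁I hd₂ (diffClosed_image_sdiff_left ht.le hpiv)
      (diffClosed_image_sdiff_right ht.le hpiv) (by rw [← hTeq]; exact hT) (by rw [← hTeq]; exact hlab)
      (by rw [← hTeq]; exact hf) (by rw [← hTeq]; exact hg) h).1
  · exact (not_blocked_of_twistedProduct hU hco hanti hd₁I hd₂ (diffClosed_image_sdiff_left ht.le hpiv)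
      (diffClosed_image_sdiff_right ht.le hpiv) (by rw [← hTeq]; exact hT) (by rw [← hTeq]; exact hlab)
      (by rw [← hTeq]; exact hg) (by rw [← hTeq]; exact hf) h).2

/-- **`cl ΔT ⊆ N(cl G)` for an MS-tight two-class dead `T` all of whose members but possibly `s` lie in the nonempty family `G ⊆ 𝒟`**: a difference
`t \ t'` is a candidate of `t` and of `U \ t'`, one of which is in `cl G` unless `t = t' = s`. -/
theorem cl_diffs_subset_biUnion_candidates_of_tight_outer (hU : ∀ a ∈ 𝒟, a ⊆ U) (hco : ∀ a ∈ 𝒟, U \ a ∈ 𝒟)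
    (hanti : ∀ a ∈ 𝒟, x (U \ a) = x a + 3) {T G : Finset (Finset α)} (hT : T ⊆ dead U 𝒟 x) {ℓ : ZMod 6}
    (hlab : ∀ t ∈ T, x t = ℓ ∨ x t = ℓ + 1) (ht : #(T \\ T) = #T) {s : Finset α} (hTG : ∀ t ∈ T, t ≠ s → t ∈ G)
    (hG : G ⊆ dead U 𝒟 x) (hGlab : ∀ g ∈ G, x g = ℓ ∨ x g = ℓ + 1) (hGne : G.Nonempty) :
    (T \\ T) ∪ (T \\ T).image (fun z => U \ z) ⊆ (G ∪ G.image fun f => U \ f).biUnion (candidates 𝒟 x) := by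
  have hTD : ∀ t ∈ T, t ∈ 𝒟 := fun t h => (mem_filter.mp (hT h)).1
  have hGD : ∀ g ∈ G, g ∈ 𝒟 := fun g h => (mem_filter.mp (hG h)).1
  have hnd : ∀ f ∈ T, ∀ g ∈ T, f \ g ∉ 𝒟 := fun f hf g hg => sdiff_notMem_of_tight hU hco hanti hT hlab ht hf hg
  have hmemA : ∀ g ∈ G, g ∈ G ∪ G.image (fun f => U \ f) := fun g hg => mem_union_left _ hg
  have hcoA : ∀ g ∈ G, U \ g ∈ G ∪ G.image (fun f => U \ f) := fun g hg => mem_union_right _ (mem_image_of_mem _ hg)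
  -- ∅ and U via a member of G
  obtain ⟨g₀, hg₀⟩ := hGne
  have hg₀nd : g₀ \ g₀ ∉ 𝒟 := (sdiff_notMem_of_dead_of_label_eq hU hco hanti (hGD _ hg₀) (hGD _ hg₀) (mem_filter.mp (hG hg₀)).2
    (mem_filter.mp (hG hg₀)).2 rfl).2
  have h00 := sdiff_mem_candidates_of_notMem hU hco hanti (hGD _ hg₀) (hGD _ hg₀) (hGlab _ hg₀) (hGlab _ hg₀) hg₀nd hg₀nd
  intro e he
  rw [mem_union, mem_image] at he
  rcases he with he | ⟨e', he', rfl⟩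
  · obtain ⟨f, hf, g, hg, rfl⟩ := Finset.mem_diffs.mp he
    by_cases hfs : f = s
    · by_cases hgs : g = s
      · -- `s \ s = ∅ = g₀ \ g₀`
        rw [hfs, hgs, Finset.sdiff_self, ← Finset.sdiff_self g₀]
        exact mem_biUnion.mpr ⟨g₀, hmemA _ hg₀, h00.1⟩
      · have h := (sdiff_mem_candidates_compl_of_notMem hU hco hanti (hTD f hf) (hTD g hg) (hlab f hf) (hlab g hg) (hnd f hf g hg)).1
        exact mem_biUnion.mpr ⟨U \ g, hcoA g (hTG g hg hgs), h⟩
    · have h := (sdiff_mem_candidates_of_notMem hU hco hanti (hTD f hf) (hTD g hg) (hlab f hf) (hlab g hg) (hnd f hf g hg) (hnd g hg f hf)).1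
      exact mem_biUnion.mpr ⟨f, hmemA f (hTG f hf hfs), h⟩
  · obtain ⟨f, hf, g, hg, rfl⟩ := Finset.mem_diffs.mp he'
    -- `U \ (f \ g)` is a candidate of `g` (partner `U \ f`) and of `U \ f` (partner `g`)
    by_cases hgs : g = s
    · by_cases hfs : f = s
      · rw [hfs, hgs, Finset.sdiff_self, ← Finset.sdiff_self g₀]
        exact mem_biUnion.mpr ⟨g₀, hmemA _ hg₀, h00.2⟩
      · have h := (sdiff_mem_candidates_compl_of_notMem hU hco hanti (hTD f hf) (hTD g hg) (hlab f hf) (hlab g hg) (hnd f hf g hg)).2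
        exact mem_biUnion.mpr ⟨U \ f, hcoA f (hTG f hf hfs), h⟩
    · have h := (sdiff_mem_candidates_of_notMem hU hco hanti (hTD g hg) (hTD f hf) (hlab g hg) (hlab f hf) (hnd g hg f hf) (hnd f hf g hg)).2
      exact mem_biUnion.mpr ⟨g, hmemA g (hTG g hg hgs), h⟩

/-- **Slack when the outside member completes an MS-tight family.**  If `G ≠ ∅` is a two-class dead family, `s ∉ G` is dead with label in `{ℓ, ℓ+1}`
and `insert s G` is MS-tight, then `#N(cl G) ≥ 2 #G + 2` (another proved instance of 'non-full ⟹ slack ≥ 2'). -/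
theorem two_mul_card_add_two_le_card_biUnion_candidates_of_insert_tight (hU : ∀ a ∈ 𝒟, a ⊆ U) (hco : ∀ a ∈ 𝒟, U \ a ∈ 𝒟)
    (hanti : ∀ a ∈ 𝒟, x (U \ a) = x a + 3) {G : Finset (Finset α)} (hG : G ⊆ dead U 𝒟 x) {ℓ : ZMod 6}
    (hGlab : ∀ g ∈ G, x g = ℓ ∨ x g = ℓ + 1) (hGne : G.Nonempty) {s : Finset α} (hs : s ∈ dead U 𝒟 x)
    (hslab : x s = ℓ ∨ x s = ℓ + 1) (hsG : s ∉ G) (ht : #((insert s G) \\ (insert s G)) = #(insert s G)) :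
    2 * #G + 2 ≤ #((G ∪ G.image fun f => U \ f).biUnion (candidates 𝒟 x)) := by
  classical
  have hT : insert s G ⊆ dead U 𝒟 x := by
    intro t ht'; rcases mem_insert.mp ht' with rfl | h; exact hs; exact hG h
  have hTlab : ∀ t ∈ insert s G, x t = ℓ ∨ x t = ℓ + 1 := by
    intro t ht'; rcases mem_insert.mp ht' with rfl | h; exact hslab; exact hGlab t h
  have hTG : ∀ t ∈ insert s G, t ≠ s → t ∈ G := fun t ht' hne => (mem_insert.mp ht').resolve_left hne
  have hsub := cl_diffs_subset_biUnion_candidates_of_tight_outer hU hco hanti hT hTlab ht hTG hG hGlab hGne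
  have hTD : ∀ t ∈ insert s G, t ∈ 𝒟 := fun t h => (mem_filter.mp (hT h)).1
  have hTU : ∀ t ∈ insert s G, t ⊆ U := fun t h => hU t (hTD t h)
  have hint : ∀ f ∈ insert s G, ∀ g ∈ insert s G, (f ∩ g).Nonempty := fun f hf g hg =>
    inter_nonempty_of_dead_of_close (hT hf) (hTD g hg) (close_of_mem_pair (hTlab f hf) (hTlab g hg))
  have hcard := card_cl_diffs_eq_two_mul hTU hint
  have h1 := card_le_card hsub
  rw [hcard, ht, card_insert_of_notMem hsG] at h1
  omega

/-- **Slack when the outside member completes an MS-tight family up to one member.**  If `G` is a two-class dead family, `s ∉ G` dead with label in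
`{ℓ, ℓ+1}`, `g ∈ G` has the upper label `ℓ + 1`, and `T = insert s (G.erase g)` is MS-tight, then `#N(cl G) ≥ 2 #G + 2`: `cl ΔT ⊆ N(cl G)` gives `2 #G`
candidates and the key lemma for `(T, g)` a further complementary pair of candidates of `g` / `U \ g`. -/
theorem two_mul_card_add_two_le_card_biUnion_candidates_of_insert_erase_tight (hU : ∀ a ∈ 𝒟, a ⊆ U) (hco : ∀ a ∈ 𝒟, U \ a ∈ 𝒟)
    (hanti : ∀ a ∈ 𝒟, x (U \ a) = x a + 3) {G : Finset (Finset α)} (hG : G ⊆ dead U 𝒟 x) {ℓ : ZMod 6}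
    (hGlab : ∀ g ∈ G, x g = ℓ ∨ x g = ℓ + 1) {s : Finset α} (hs : s ∈ dead U 𝒟 x) (hslab : x s = ℓ ∨ x s = ℓ + 1) (hsG : s ∉ G)
    {g : Finset α} (hg : g ∈ G) (hglab : x g = ℓ + 1)
    (ht : #((insert s (G.erase g)) \\ (insert s (G.erase g))) = #(insert s (G.erase g))) :
    2 * #G + 2 ≤ #((G ∪ G.image fun f => U \ f).biUnion (candidates 𝒟 x)) := by
  classical
  set T := insert s (G.erase g) with hTdef
  have hsT : s ∈ T := mem_insert_self _ _
  have hT : T ⊆ dead U 𝒟 x := by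
    intro t ht'; rcases mem_insert.mp ht' with rfl | h; exact hs; exact hG (mem_of_mem_erase h)
  have hTlab : ∀ t ∈ T, x t = ℓ ∨ x t = ℓ + 1 := by
    intro t ht'; rcases mem_insert.mp ht' with rfl | h; exact hslab; exact hGlab t (mem_of_mem_erase h)
  have hTG : ∀ t ∈ T, t ≠ s → t ∈ G := fun t ht' hne => mem_of_mem_erase ((mem_insert.mp ht').resolve_left hne)
  have hgT : g ∉ T := by
    intro h; rcases mem_insert.mp h with h | h
    · exact hsG (h ▸ hg)
    · exact (notMem_erase g G) h
  have hTD : ∀ t ∈ T, t ∈ 𝒟 := fun t h => (mem_filter.mp (hT h)).1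
  have hTU : ∀ t ∈ T, t ⊆ U := fun t h => hU t (hTD t h)
  have hgD : g ∈ 𝒟 := (mem_filter.mp (hG hg)).1
  have hcc : ∀ a : Finset α, a ⊆ U → U \ (U \ a) = a := fun a ha => Finset.sdiff_sdiff_eq_self ha
  set N := (G ∪ G.image fun f => U \ f).biUnion (candidates 𝒟 x) with hN
  set X := (T \\ T) ∪ (T \\ T).image (fun z => U \ z) with hX
  have hXN : X ⊆ N := cl_diffs_subset_biUnion_candidates_of_tight_outer hU hco hanti hT hTlab ht hTG hG hGlab ⟨g, hg⟩
  have hint : ∀ f ∈ T, ∀ f' ∈ T, (f ∩ f').Nonempty := fun f hf f' hf' =>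
    inter_nonempty_of_dead_of_close (hT hf) (hTD f' hf') (close_of_mem_pair (hTlab f hf) (hTlab f' hf'))
  have hXcard : #X = 2 * #(T \\ T) := card_cl_diffs_eq_two_mul hTU hint
  have hTcard : #T = #G := by
    rw [hTdef, card_insert_of_notMem (fun h => hsG (mem_of_mem_erase h)), card_erase_of_mem hg]
    have := card_pos.mpr ⟨g, hg⟩; omega
  -- pivot of T and the key lemma for the new member g
  obtain ⟨c, hcT, hpiv⟩ := TwistedAD.exists_pivot_of_card_diffs_eq_card T ht ⟨s, hsT⟩
  have htp := tp_mem_of_pivot ht.le hpiv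
  have hsplit : ∀ e ∈ T \\ T, e ∩ c ∈ T.image (c \ ·) ∧ e \ c ∈ T.image (· \ c) := fun e he => mem_diffs_pivot_split ht.le hpiv he
  obtain ⟨w, hw, hw1, hw2⟩ := exists_candidate_notMem_cl_diffs'' hU hco hanti hT hTlab (hG hg) hglab hgT hcT htp hsplit
  have hgA : g ∈ G ∪ G.image (fun f => U \ f) := mem_union_left _ hg
  have hcgA : U \ g ∈ G ∪ G.image (fun f => U \ f) := mem_union_right _ (mem_image_of_mem _ hg)
  have hwN : w ∈ N ∧ U \ w ∈ N ∧ w ⊆ U := by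
    rcases hw with hw | hw
    · refine ⟨mem_biUnion.mpr ⟨g, hgA, hw⟩, mem_biUnion.mpr ⟨U \ g, hcgA, ?_⟩, candidates_subset_ground hU hgD hw⟩
      rw [candidates_compl hU hco hanti hgD]; exact mem_image_of_mem _ hw
    · refine ⟨mem_biUnion.mpr ⟨U \ g, hcgA, hw⟩, mem_biUnion.mpr ⟨g, hgA, ?_⟩, candidates_subset_ground hU (hco g hgD) hw⟩
      have h := candidates_compl hU hco hanti (hco g hgD)
      rw [hcc g (hU g hgD)] at h
      rw [h]; exact mem_image_of_mem _ hw
  obtain ⟨hwN1, hwN2, hwU⟩ := hwN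
  have hXU : ∀ e ∈ T \\ T, e ⊆ U := by
    intro e he; obtain ⟨f, hf, f', _, rfl⟩ := Finset.mem_diffs.mp he; exact sdiff_subset.trans (hTU f hf)
  have hcw : U \ w ∉ X := by
    intro h
    rw [hX, mem_union, mem_image] at h
    rcases h with h | ⟨e, he, hee⟩
    · exact hw2 (mem_image.mpr ⟨U \ w, h, hcc w hwU⟩)
    · apply hw1
      have : e = w := by
        have h1 := congrArg (fun t => U \ t) hee
        simp only [hcc e (hXU e he), hcc w hwU] at h1
        exact h1
      rw [← this]; exact he
  have hwX : w ∉ X := fun h => by rw [hX, mem_union] at h; exact h.elim hw1 hw2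
  have h1 := card_add_two_le_card_of_pair hXN hwN1 hwN2 hwX hcw (ne_compl_of_dead hU hs w)
  rw [hXcard, ht, hTcard] at h1
  exact h1

/-- **(S2) Blocker-free and not MS-tight ⟹ slack ≥ 2.**  If a two-class dead family `G` has no blocked pair (no cross difference of members with adjacent
labels is a member) and `#ΔG ≥ #G + 1`, then `#N(cl G) ≥ 2 #G + 2`: all of `cl ΔG` consists of candidates and `#cl ΔG = 2 #ΔG`. -/
theorem two_mul_card_add_two_le_card_biUnion_candidates_of_noBlocker (hU : ∀ a ∈ 𝒟, a ⊆ U) (hco : ∀ a ∈ 𝒟, U \ a ∈ 𝒟)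
    (hanti : ∀ a ∈ 𝒟, x (U \ a) = x a + 3) {G : Finset (Finset α)} (hG : G ⊆ dead U 𝒟 x) {ℓ : ZMod 6}
    (hGlab : ∀ g ∈ G, x g = ℓ ∨ x g = ℓ + 1)
    (hnb : ∀ p ∈ G, ∀ q ∈ G, x q = x p + 1 → p \ q ∉ 𝒟 ∧ q \ p ∉ 𝒟) (hex : #G + 1 ≤ #(G \\ G)) :
    2 * #G + 2 ≤ #((G ∪ G.image fun f => U \ f).biUnion (candidates 𝒟 x)) := by
  have hGD : ∀ g ∈ G, g ∈ 𝒟 := fun g h => (mem_filter.mp (hG h)).1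
  have hGU : ∀ g ∈ G, g ⊆ U := fun g h => hU g (hGD g h)
  have key : ∀ i s t : ZMod 6, (s = i ∨ s = i + 1) → (t = i ∨ t = i + 1) → s = t ∨ t = s + 1 ∨ s = t + 1 := by decide
  have hnd : ∀ f ∈ G, ∀ g ∈ G, f \ g ∉ 𝒟 := by
    intro f hf g hg
    rcases key ℓ _ _ (hGlab f hf) (hGlab g hg) with h | h | h
    · exact (sdiff_notMem_of_dead_of_label_eq hU hco hanti (hGD f hf) (hGD g hg) (mem_filter.mp (hG hf)).2
        (mem_filter.mp (hG hg)).2 h).2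
    · exact (hnb f hf g hg h).1
    · exact (hnb g hg f hf h).2
  have hsub : (G \\ G) ∪ (G \\ G).image (fun z => U \ z) ⊆ (G ∪ G.image fun f => U \ f).biUnion (candidates 𝒟 x) := by
    intro e he
    rw [mem_union, mem_image] at he
    rcases he with he | ⟨e', he', rfl⟩
    · obtain ⟨f, hf, g, hg, rfl⟩ := Finset.mem_diffs.mp he
      exact mem_biUnion.mpr ⟨f, mem_union_left _ hf, (sdiff_mem_candidates_of_notMem hU hco hanti (hGD f hf) (hGD g hg)
        (hGlab f hf) (hGlab g hg) (hnd f hf g hg) (hnd g hg f hf)).1⟩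
    · obtain ⟨g, hg, f, hf, rfl⟩ := Finset.mem_diffs.mp he'
      exact mem_biUnion.mpr ⟨f, mem_union_left _ hf, (sdiff_mem_candidates_of_notMem hU hco hanti (hGD f hf) (hGD g hg)
        (hGlab f hf) (hGlab g hg) (hnd f hf g hg) (hnd g hg f hf)).2⟩
  have hint : ∀ f ∈ G, ∀ g ∈ G, (f ∩ g).Nonempty := fun f hf g hg =>
    inter_nonempty_of_dead_of_close (hG hf) (hGD g hg) (close_of_mem_pair (hGlab f hf) (hGlab g hg))
  have hcard := card_cl_diffs_eq_two_mul hGU hint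
  have h1 := card_le_card hsub
  rw [hcard] at h1
  omega

end OuterTight

end GeneratedDonors

end Summit.CriticalPhenomena.PercolationContinuityZ3.Theorems
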